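import Summits.QuantumFields.Balaban3D.Proofs.StandardAC

/-!
# `Summit.QuantumFields.Balaban3D.Proofs.MassesPAC` — the masses of (41) with the trivial history PINNED TO `1` (print's trivial weight) and every
# other history the EXACT Radon–Nikodym transport built on it — lane `pub-balaban3d`, seat alpha-1 (the mass family of the proposed v3 reading of the
# residual rows; crux `HistoryTailL` of route `UnitScaleTilt`, line v5p4 STUB 2‴)

WHY.  The lane's `MassesAC.massRecAC` FLOORS the trivial history (`max 1 (T_k[m_k(triv)])`) so that the R-RN barrier `lower ≤ upper` holds pointwise;
for an averaging that is only absolutely continuous the floors compound (`TrivMassAC.integral_massRecAC_triv_le`: `∫ m_k(triv) ≤ k + 1`, not uniform in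
the cut-off — seat finding F-α1-11, lead finding F-g3-3, the E6′ seam).  Print's trivial weight is the characteristic function, mass `1`: [Balaban1985UV3]
(47) p.267, (55) p.269 at `Ω_{k+1} = T_η` (p.272 L32–33), where the bound (49) ≤ (55)·(58) is UNFACTORED (no large-field mass; crux-idea card
`unfactored-trivial-row`, FINDING N7 of cell ym3-torus).  THIS FILE types that mass family: `massRecP 0 = 1`; `massRecP (k+1) triv = 1`;
`massRecP (k+1) h′ = T_k[w_k(h′)·massRecP k (proj h′)]` for admissible non-trivial `h′`; `0` otherwise.  Everything is [folklore] measure theory: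
`≥ 0`, measurable, integrable, **`∫ massRecP k h dV ≤ 1` for EVERY history, uniformly in the level** (transport preserves `∫`, `w ≤ 1`; no floor),
vanishing off admissible histories, and the decomposition-of-unity covering `hcover`.  What it does NOT have is the lane's `hm₁` at the trivial history
(`T_k[1] ≤ 1` would be exact Haar compatibility, F-α1-1): the (41) step for this family uses the DIRECT fibre form (`WindowStepAC`), whose trivial
instance is the unfactored row.  Nothing of [Balaban1985UV3] is asserted.

References: T. Bałaban, Commun. Math. Phys. 102 (1985) 255–275 [Balaban1985UV3] ((41) p.266, (47)–(48) pp.267–268, (55) p.269).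
-/

noncomputable section

namespace Summit.QuantumFields.Balaban3D.Proofs.MassesPAC

open _root_.MeasureTheory
open Literature.MathematicalPhysics.QuantumFieldTheory.Balaban1983to89
open Literature.MathematicalPhysics.QuantumFieldTheory.Balaban1983to89.AveragingRT (rnTransport rnTransport_nonneg)
open Summit.QuantumFields.Balaban3D.Carriers
open Summit.QuantumFields.Balaban3D.Proofs.Bound55Masses (chiB stepWeight_mul_chiB_cover rnTransport_zero_ae)
open Summit.QuantumFields.Balaban3D.Proofs.MassesAC (integrable_stepWeight_mul)
open Summit.QuantumFields.Balaban3D.Proofs.TowerAC (HistWeightsAC)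

variable {P : Params} {G : Type} [GaugeGroup G] [MeasurableSpace G] [HaarData G]
  (M₁ : ℕ) (Rcol : ℕ → ℕ) (εL εS : ℕ → ℝ) (av : ∀ j, Averaging P j G)

/-! ## §1 The recursion -/

open Classical in
/-- **THE MASSES OF (41) WITH THE TRIVIAL HISTORY PINNED TO `1`**: `m_0 = 1`; `m_{k+1}(triv) = 1` (print's trivial weight: (47) p.267, p.272 L32–33
«Ω_{k+1} = T_η»); `m_{k+1}(h′) = T_k[w_k(h′)·m_k(proj h′)]` for admissible non-trivial `h′` (the exact transport of (48), no truncation); `0` for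
inadmissible `h′`. [cite: Balaban1985UV3, (41) p.266 + (47)–(48) pp.267–268] -/
def massRecP : (k : ℕ) → Hist P k → GaugeField P k G → ℝ
  | 0, _, _ => 1
  | k + 1, h, V =>
      if h = Hist.triv P (k + 1) then 1
      else if Hist.Admissible M₁ Rcol (k + 1) h then
        rnTransport (av k).avg (fun U => stepWeight M₁ Rcol εL εS k h U * massRecP k h.proj U) V
      else 0

/-- `m_0 = 1`. [folklore] -/
theorem massRecP_zero (h : Hist P 0) (V : GaugeField P 0 G) : massRecP M₁ Rcol εL εS av 0 h V = 1 := rfl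

open Classical in
/-- **The trivial history has mass `1` at every level, pointwise.** [cite: Balaban1985UV3, (47) p.267] -/
theorem massRecP_triv : ∀ (k : ℕ) (V : GaugeField P k G), massRecP M₁ Rcol εL εS av k (Hist.triv P k) V = 1
  | 0, _ => rfl
  | k + 1, V => by
    show ite _ _ _ = _
    rw [if_pos rfl]

open Classical in
/-- **Inadmissible histories have mass `0`, pointwise.** [folklore] -/
theorem massRecP_eq_zero_of_not_admissible : ∀ (k : ℕ) (h : Hist P k) (V : GaugeField P k G),
    ¬ Hist.Admissible M₁ Rcol k h → massRecP M₁ Rcol εL εS av k h V = 0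
  | 0, _, _, hh => absurd trivial hh
  | k + 1, h, V, hh => by
    show ite _ _ _ = 0
    rw [if_neg (fun ht => hh (by rw [ht]; exact Hist.admissible_triv M₁ Rcol (k + 1))), if_neg hh]

open Classical in
/-- **The recursion step for an ADMISSIBLE, NON-TRIVIAL history is the exact transport, pointwise.** [cite: Balaban1985UV3, (48) p.268] -/
theorem massRecP_succ (k : ℕ) (h : Hist P (k + 1)) (hh : Hist.Admissible M₁ Rcol (k + 1) h) (ht : h ≠ Hist.triv P (k + 1))
    (V : GaugeField P (k + 1) G) :
    massRecP M₁ Rcol εL εS av (k + 1) h V =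
      rnTransport (av k).avg (fun U => stepWeight M₁ Rcol εL εS k h U * massRecP M₁ Rcol εL εS av k h.proj U) V := by
  show ite _ _ _ = _
  rw [if_neg ht, if_pos hh]

open Classical in
/-- `m ≥ 0`. [folklore] -/
theorem massRecP_nonneg : ∀ (k : ℕ) (h : Hist P k) (V : GaugeField P k G), 0 ≤ massRecP M₁ Rcol εL εS av k h V
  | 0, _, _ => zero_le_one
  | k + 1, h, V => by
    by_cases ht : h = Hist.triv P (k + 1)
    · subst ht; rw [massRecP_triv]; exact zero_le_one
    by_cases hh : Hist.Admissible M₁ Rcol (k + 1) h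
    · rw [massRecP_succ M₁ Rcol εL εS av k h hh ht V]
      exact rnTransport_nonneg _ _
        (fun U => mul_nonneg (stepWeight_nonneg M₁ Rcol εL εS k h U) (massRecP_nonneg k _ U)) V
    · rw [massRecP_eq_zero_of_not_admissible M₁ Rcol εL εS av (k + 1) h V hh]

/-- The three cases of the successor as ONE formula: `m_{k+1}(h′) = 𝟙[h′ = triv] + 𝟙[h′ ≠ triv]·T_k[w·m_k(proj h′)]` on admissible `h′` — recorded as
the function identity used for measurability/integrability. [folklore] -/
theorem massRecP_succ_fun (k : ℕ) (h : Hist P (k + 1)) (hh : Hist.Admissible M₁ Rcol (k + 1) h) (ht : h ≠ Hist.triv P (k + 1)) :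
    massRecP M₁ Rcol εL εS av (k + 1) h =
      rnTransport (av k).avg (fun U => stepWeight M₁ Rcol εL εS k h U * massRecP M₁ Rcol εL εS av k h.proj U) :=
  funext fun V => massRecP_succ M₁ Rcol εL εS av k h hh ht V

/-! ## §2 Measurability, integrability, and the CUT-OFF-UNIFORM integral bound -/

/-- **The masses are measurable.** [folklore] -/
theorem measurable_massRecP : ∀ (k : ℕ) (h : Hist P k), Measurable (massRecP M₁ Rcol εL εS av k h)
  | 0, _ => measurable_const
  | k + 1, h => by
    by_cases ht : h = Hist.triv P (k + 1)
    · subst ht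
      have : massRecP M₁ Rcol εL εS av (k + 1) (Hist.triv P (k + 1)) = fun _ => 1 :=
        funext fun V => massRecP_triv M₁ Rcol εL εS av (k + 1) V
      rw [this]; exact measurable_const
    by_cases hh : Hist.Admissible M₁ Rcol (k + 1) h
    · rw [massRecP_succ_fun M₁ Rcol εL εS av k h hh ht]; exact measurable_rnTransport _ _
    · have : massRecP M₁ Rcol εL εS av (k + 1) h = fun _ => 0 :=
        funext fun V => massRecP_eq_zero_of_not_admissible M₁ Rcol εL εS av (k + 1) h V hh
      rw [this]; exact measurable_const

variable [RegularGaugeGroup G]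

/-- **The masses are integrable.** [folklore] -/
theorem integrable_massRecP : ∀ (k : ℕ) (h : Hist P k), Integrable (massRecP M₁ Rcol εL εS av k h) (fieldMeasure P k G)
  | 0, _ => integrable_const _
  | k + 1, h => by
    by_cases ht : h = Hist.triv P (k + 1)
    · subst ht
      have : massRecP M₁ Rcol εL εS av (k + 1) (Hist.triv P (k + 1)) = fun _ => 1 :=
        funext fun V => massRecP_triv M₁ Rcol εL εS av (k + 1) V
      rw [this]; exact integrable_const _
    by_cases hh : Hist.Admissible M₁ Rcol (k + 1) h
    · rw [massRecP_succ_fun M₁ Rcol εL εS av k h hh ht]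
      exact integrable_rnTransport _ _ (integrable_stepWeight_mul M₁ Rcol εL εS k h (integrable_massRecP k h.proj))
    · have : massRecP M₁ Rcol εL εS av (k + 1) h = fun _ => 0 :=
        funext fun V => massRecP_eq_zero_of_not_admissible M₁ Rcol εL εS av (k + 1) h V hh
      rw [this]; exact integrable_const _

/-- **`∫ m_k(h) dV ≤ 1` FOR EVERY HISTORY AND EVERY LEVEL** (uniform in the cut-off): the trivial mass is `1` on a probability space; the transport
preserves the integral (`Carriers.integral_rnTransport_of_ac`) and `w ≤ 1`. [folklore] -/
theorem integral_massRecP_le_one (hav : ∀ j, AvgAC (av j).avg) :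
    ∀ (k : ℕ) (h : Hist P k), ∫ V, massRecP M₁ Rcol εL εS av k h V ∂(fieldMeasure P k G) ≤ 1
  | 0, _ => by simp [massRecP_zero]
  | k + 1, h => by
    by_cases ht : h = Hist.triv P (k + 1)
    · subst ht; simp [massRecP_triv]
    by_cases hh : Hist.Admissible M₁ Rcol (k + 1) h
    · have hwm := integrable_stepWeight_mul M₁ Rcol εL εS k h (integrable_massRecP M₁ Rcol εL εS av k h.proj)
      rw [massRecP_succ_fun M₁ Rcol εL εS av k h hh ht, integral_rnTransport_of_ac (hav k) _ hwm]
      have hle : ∀ U, stepWeight M₁ Rcol εL εS k h U * massRecP M₁ Rcol εL εS av k h.proj U ≤ massRecP M₁ Rcol εL εS av k h.proj U :=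
        fun U => by
          have h1 := stepWeight_le_one M₁ Rcol εL εS k h U
          have h0 := massRecP_nonneg M₁ Rcol εL εS av k h.proj U
          nlinarith
      exact (integral_mono hwm (integrable_massRecP M₁ Rcol εL εS av k h.proj) hle).trans (integral_massRecP_le_one hav k h.proj)
    · have : massRecP M₁ Rcol εL εS av (k + 1) h = fun _ => 0 :=
        funext fun V => massRecP_eq_zero_of_not_admissible M₁ Rcol εL εS av (k + 1) h V hh
      rw [this]; simp

/-! ## §3 The covering and the `HistWeightsAC` packaging -/

omit [RegularGaugeGroup G] in
/-- **`hcover` FOR THE PINNED MASSES**: wherever `m_k(h, U) ≠ 0` (so `h` is admissible) the new history `h ⌢ P_k(U)` has full weight (seat p4's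
`stepWeight_mul_chiB_cover`; needs `εL k ≤ εS k`). [cite: Balaban1985UV3, (7)–(8) pp.257–258] -/
theorem massRecP_cover (k : ℕ) (hLS : εL k ≤ εS k) (h : Hist P k) (U : GaugeField P k G)
    (hm : massRecP M₁ Rcol εL εS av k h U ≠ 0) :
    ∃ h' : Hist P (k + 1), h'.proj = h ∧
      (1 : ℝ) ≤ stepWeight M₁ Rcol εL εS k h' U * chiB M₁ Rcol εL k h' U := by
  have hh : Hist.Admissible M₁ Rcol k h := by
    by_contra hna
    exact hm (massRecP_eq_zero_of_not_admissible M₁ Rcol εL εS av k h U hna)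
  exact ⟨_, stepWeight_mul_chiB_cover M₁ Rcol εL εS k hLS h hh U⟩

omit [RegularGaugeGroup G] in
/-- For an inadmissible new history the transported weighted mass vanishes a.e. (the weight is identically `0`). [folklore] -/
theorem transport_eq_zero_ae_of_not_admissible (k : ℕ) (h' : Hist P (k + 1)) (hh : ¬ Hist.Admissible M₁ Rcol (k + 1) h') :
    rnTransport (av k).avg (fun U => stepWeight M₁ Rcol εL εS k h' U * massRecP M₁ Rcol εL εS av k h'.proj U)
      =ᵐ[fieldMeasure P (k + 1) G] fun _ => (0 : ℝ) := by
  have hint : (fun U => stepWeight M₁ Rcol εL εS k h' U * massRecP M₁ Rcol εL εS av k h'.proj U) = fun _ => (0 : ℝ) :=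
    funext fun U => by rw [stepWeight_of_not_admissible M₁ Rcol εL εS k hh U, zero_mul]
  rw [hint]
  exact rnTransport_zero_ae k (av k).avg

/-- **`HistWeightsAC` INHABITED by the pinned masses.** [cite: Balaban1985UV3, (41) p.266] -/
noncomputable def histWeightsP : HistWeightsAC P G where
  mass := massRecP M₁ Rcol εL εS av
  mass_nonneg := massRecP_nonneg M₁ Rcol εL εS av
  mass_zero := massRecP_zero M₁ Rcol εL εS av

end Summit.QuantumFields.Balaban3D.Proofs.MassesPAC

end
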